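import Summits.CriticalPhenomena.PercolationContinuityZ3.Theorems.Transplant.PlanarSkeletonFrmFromDefs
import Summits.CriticalPhenomena.PercolationContinuityZ3.Theorems.Transplant.SkelFrmFromBParamsCorrKGY
import Summits.CriticalPhenomena.PercolationContinuityZ3.Theorems.Transplant.SkelFrmBParamsCorrKGY
import HarnessLib
import Summits.CriticalPhenomena.PercolationContinuityZ3.Theorems.Transplant.SkelFrmBParamsCorrKG0
/-!
# U-WAVE PORT (RULING D-U, lead g21 2026-08-26; WAVE-U-MANIFEST v3.1 row «SkelFrmBParamsCorrKG0» ↦ «SkelFrmFromBParamsCorrKG0») of the tree module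
# `Transplant/SkelFrmBParamsCorrKG0` onto the carrier `PlanarSkeletonFrmFrom` (frames only, cylinders connected from width `ℓ₀` on)

ORIGINAL TITLE: N2 (frames-only node `SamePDropOfSkeletonFrmFrom₁`, OPEN) — (ζ″) ledger, THE K-G CORRIDOR SLOT VALUES AT `ρ := 0` (the instantiation OF RECORD after

builds on p205010 (kernel theorem, internal audit signed; external expert review pending) — nothing in this file uses p205010; NOTHING is claimed about the
OPEN node U `SamePDropOfSkeletonFrmFrom₁` (nor U_s / the end state).  Lane `prim-bschramm`, seat `prim-bschramm-stmt` gen 26 (port pen, RULING M-11 family P-stmt; tool = p3-g26's port_u.py of record, registry-driven inputs); helper file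
(`--supports stmt-CriticalPhenomena-4575 --as helper`).  PORT RULES r1–r4 of RULING D-U: declaration order and proof texts are those of the original,
byte-identical except (i) the carrier token `PlanarSkeletonFrm ↦ PlanarSkeletonFrmFrom` (binders, `namespace`/`end` lines, qualified names of twinned
declarations), (ii) carrier-FREE declarations of the original (φ-level `Skelφ…` blocks and namespace-only arithmetic residents) are NOT re-declared —
this file imports the original and `export`s the twin-free residents (POLICY T / treatment (m1)); residents whose statement mentions a twinned
constant are copied, (iii) every carrier-binding declaration keeps its explicit binder `(Φ : PlanarSkeletonFrmFrom G)` in its own signature (r2).  Docstrings and citations are the original's.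
-/

open scoped Classical

noncomputable section

namespace Summit.CriticalPhenomena.PercolationContinuityZ3.Theorems.Transplant

namespace PlanarSkeletonFrmFrom

namespace NegB

open Literature.Probability.Percolation Literature.Probability.LatticeModels SimpleGraph
open SkelConc (Consts)
open Skelφ (shearUnit kgSL kgSLY kgP kgΔ kgΔY kgN kgNY KGRows KGYRows)
open Neg

/-! ## §1 The inputs at `ρ := 0` -/

section Inputs0

variable (κ : Consts) {V : Type} [DecidableEq V] [Countable V] {G : SimpleGraph V} [G.LocallyFinite] (Φ : PlanarSkeletonFrmFrom G) (t : V) (p : unitInterval)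
  (D : Skelφ.StepI.DataNS V) (g f mk qx Wx : ℕ)

/-- **The steering target at `ρ := 0`**: `pitch + (n − 1)/2 + (n + Δ₀)/2`, `Δ₀ := kgΔ v R′ 0 = 8R′ + |v|`. [this work] -/
def kgTgt0 (κ : Consts) {V : Type} [DecidableEq V] [Countable V] {G : SimpleGraph V} [G.LocallyFinite] (Φ : PlanarSkeletonFrmFrom G) (t : V) (p : unitInterval) (D : Skelφ.StepI.DataNS V) (g : ℕ) (f : ℕ) (mk : ℕ) : ℤ :=
  pitch κ Φ t p D g f + ((nL κ Φ t p D g f : ℤ) - 1) / 2 + ((nL κ Φ t p D g f : ℤ) + kgΔ (vL κ Φ t p D g f) (kgR κ Φ t p D mk) 0) / 2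

/-- **The run length of record at `ρ := 0`**. [this work] -/
def kgNv0 (κ : Consts) {V : Type} [DecidableEq V] [Countable V] {G : SimpleGraph V} [G.LocallyFinite] (Φ : PlanarSkeletonFrmFrom G) (t : V) (p : unitInterval) (D : Skelφ.StepI.DataNS V) (g : ℕ) (f : ℕ) (mk : ℕ) (qx : ℕ) (Wx : ℕ) : ℕ :=
  kgN (nL κ Φ t p D g f) (ℓL κ Φ t p D g f) (hL κ Φ t p D g f) (vL κ Φ t p D g f) (kgR κ Φ t p D mk) 0 (kgq κ Φ t p D g f qx)
    (kgW κ Φ t p D g f Wx) (kgTgt0 κ Φ t p D g f mk)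

/-- **The second-axis steering target at `ρ := 0`**: `pitchY + (P − 1)/2 + (sL + ΔY₀)/2`. [this work] -/
def kgTgtY0 (κ : Consts) {V : Type} [DecidableEq V] [Countable V] {G : SimpleGraph V} [G.LocallyFinite] (Φ : PlanarSkeletonFrmFrom G) (t : V) (p : unitInterval) (D : Skelφ.StepI.DataNS V) (g : ℕ) (f : ℕ) (mk : ℕ) : ℤ :=
  pitchY κ Φ t p D g f + ((((nL κ Φ t p D g f * ℓL κ Φ t p D g f / shearUnit (nL κ Φ t p D g f) (hL κ Φ t p D g f) + 1 : ℕ) : ℤ) - 1) / 2) +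
    (kgSLY (nL κ Φ t p D g f) (ℓL κ Φ t p D g f) (hL κ Φ t p D g f) + kgΔY (kgR κ Φ t p D mk) 0) / 2

/-- **The second-axis run length of record at `ρ := 0`**. [this work] -/
def kgNYv0 (κ : Consts) {V : Type} [DecidableEq V] [Countable V] {G : SimpleGraph V} [G.LocallyFinite] (Φ : PlanarSkeletonFrmFrom G) (t : V) (p : unitInterval) (D : Skelφ.StepI.DataNS V) (g : ℕ) (f : ℕ) (mk : ℕ) (qx : ℕ) (Wx : ℕ) : ℕ :=
  kgNY (nL κ Φ t p D g f) (ℓL κ Φ t p D g f) (hL κ Φ t p D g f) (vL κ Φ t p D g f) (kgR κ Φ t p D mk) 0 (kgqY κ Φ t p D g f qx)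
    (kgWY κ Φ t p D g f Wx) (kgTgtY0 κ Φ t p D g f mk)

end Inputs0

/-! ## §2 The rows for any `ρ ≤ M_u + 1`, and at `ρ := 0` -/

section Rows0

variable (κ : Consts) {V : Type} [DecidableEq V] [Countable V] {G : SimpleGraph V} [G.LocallyFinite] (Φ : PlanarSkeletonFrmFrom G) (t : V) (p : unitInterval)
  (D : Skelφ.StepI.DataNS V) (g f : ℕ)

/-- **THE ROWS FOR ANY `ρ ≤ M_u + 1`** with the split row `ρ + |v_L| ≤ n_L` explicit. [this work] -/
theorem kgRowsρ_of (κ : Consts) {V : Type} [DecidableEq V] [Countable V] {G : SimpleGraph V} [G.LocallyFinite] (Φ : PlanarSkeletonFrmFrom G) (t : V) (p : unitInterval) (D : Skelφ.StepI.DataNS V) (g : ℕ) (f : ℕ) (mk qx Wx ρ : ℕ) (hρ : ρ ≤ Mu D + 1) (hN : EqNumL κ Φ t p D g f) (hg : gFloorKG κ Φ t p D mk ≤ g)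
    (hρv : (ρ : ℤ) + |vL κ Φ t p D g f| ≤ nL κ Φ t p D g f) :
    KGRows (nL κ Φ t p D g f) (ℓL κ Φ t p D g f) (hL κ Φ t p D g f) (vL κ Φ t p D g f) (kgR κ Φ t p D mk) ρ (kgq κ Φ t p D g f qx)
      (kgW κ Φ t p D g f Wx) := by
  obtain ⟨hn1, -⟩ := one_le_of_eqNumL κ Φ t p D g f hN
  have hnle := hN.n_le
  have hgML : g ≤ ML κ Φ t p D g := (ML_le_ML κ Φ t p D g).2
  have hsL := ML_sub_one_le_kgSL κ Φ t p D g f hN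
  have hMU := Mu_mul_U_le κ Φ t p D g f hN
  have hUpos : 0 < shearUnit (nL κ Φ t p D g f) (hL κ Φ t p D g f) := by unfold Skelφ.shearUnit; omega
  unfold gFloorKG at hg
  refine ⟨hn1, hN.v_le, hlay_at κ Φ t p D g f hN, ?_, ?_, hρv, ?_, ?_, ?_, ?_⟩
  · -- hR₁
    unfold kgR
    have : ((8 * KS0.R'0 κ Φ t p D mk + 3 * Mu D + 6 : ℕ) : ℤ) ≤ ML κ Φ t p D g := by exact_mod_cast hg.trans hgML
    have hρ' : (ρ : ℤ) ≤ (Mu D : ℤ) + 1 := by exact_mod_cast hρ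
    push_cast at this ⊢
    linarith
  · -- hR₂
    unfold kgR
    have : ((ML κ Φ t p D g : ℕ) : ℤ) + 1 ≤ nL κ Φ t p D g f := hnle
    have hMn : ML κ Φ t p D g + 1 ≤ nL κ Φ t p D g f := by exact_mod_cast this
    omega
  · -- hρP
    unfold Skelφ.kgP
    have : Mu D ≤ nL κ Φ t p D g f * ℓL κ Φ t p D g f / shearUnit (nL κ Φ t p D g f) (hL κ Φ t p D g f) := (Nat.le_div_iff_mul_le hUpos).2 hMU
    omega
  · -- hρL
    have h3 : Mu D * shearUnit (nL κ Φ t p D g f) (hL κ Φ t p D g f) ≤ 3 * (nL κ Φ t p D g f * ℓL κ Φ t p D g f) := by omega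
    have : Mu D ≤ 3 * (nL κ Φ t p D g f * ℓL κ Φ t p D g f) / shearUnit (nL κ Φ t p D g f) (hL κ Φ t p D g f) := (Nat.le_div_iff_mul_le hUpos).2 h3
    omega
  · -- hq
    unfold kgq
    have := hN.v_le
    push_cast; linarith
  · -- hW
    unfold kgW
    have := Int.self_le_toNat (kgSL (nL κ Φ t p D g f) (ℓL κ Φ t p D g f) (hL κ Φ t p D g f))
    have h0 : (0 : ℤ) ≤ ((kgSL (nL κ Φ t p D g f) (ℓL κ Φ t p D g f) (hL κ Φ t p D g f)).toNat : ℤ) := by positivity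
    have h1 : (0 : ℤ) ≤ (Wx : ℤ) := by positivity
    push_cast
    linarith

/-- **THE ROWS OF RECORD, FIRST AXIS, `ρ := 0`** — from `EqNumL` and the box-slot floor alone (the split row is `EqNumL.v_le`). [this work] -/
theorem kgRows0_of (κ : Consts) {V : Type} [DecidableEq V] [Countable V] {G : SimpleGraph V} [G.LocallyFinite] (Φ : PlanarSkeletonFrmFrom G) (t : V) (p : unitInterval) (D : Skelφ.StepI.DataNS V) (g : ℕ) (f : ℕ) (mk qx Wx : ℕ) (hN : EqNumL κ Φ t p D g f) (hg : gFloorKG κ Φ t p D mk ≤ g) :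
    KGRows (nL κ Φ t p D g f) (ℓL κ Φ t p D g f) (hL κ Φ t p D g f) (vL κ Φ t p D g f) (kgR κ Φ t p D mk) 0 (kgq κ Φ t p D g f qx)
      (kgW κ Φ t p D g f Wx) :=
  kgRowsρ_of κ Φ t p D g f mk qx Wx 0 (Nat.zero_le _) hN hg (by simpa using hN.v_le)

/-- **THE SECOND-AXIS ROWS FOR ANY `ρ ≤ M_u + 1`**. [this work] -/
theorem kgYRowsρ_of (κ : Consts) {V : Type} [DecidableEq V] [Countable V] {G : SimpleGraph V} [G.LocallyFinite] (Φ : PlanarSkeletonFrmFrom G) (t : V) (p : unitInterval) (D : Skelφ.StepI.DataNS V) (g : ℕ) (f : ℕ) (mk qx Wx ρ : ℕ) (hρ : ρ ≤ Mu D + 1) (hN : EqNumL κ Φ t p D g f) (hg : gFloorKG κ Φ t p D mk ≤ g)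
    (hρv : (ρ : ℤ) + |vL κ Φ t p D g f| ≤ nL κ Φ t p D g f) :
    KGYRows (nL κ Φ t p D g f) (ℓL κ Φ t p D g f) (hL κ Φ t p D g f) (vL κ Φ t p D g f) (kgR κ Φ t p D mk) ρ (kgqY κ Φ t p D g f qx)
      (kgWY κ Φ t p D g f Wx) := by
  have H := kgRowsρ_of κ Φ t p D g f mk qx Wx ρ hρ hN hg hρv
  have hgML : g ≤ ML κ Φ t p D g := (ML_le_ML κ Φ t p D g).2
  have hsL := ML_sub_one_le_kgSL κ Φ t p D g f hN
  unfold gFloorKG at hg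
  refine ⟨H.hn, H.hv, H.hlay, ?_, H.hR₂, H.hρv, H.hρL, ?_, ?_⟩
  · rw [kgSLY_eq_kgSL]
    unfold kgR
    have : ((8 * KS0.R'0 κ Φ t p D mk + 3 * Mu D + 6 : ℕ) : ℤ) ≤ ML κ Φ t p D g := by exact_mod_cast hg.trans hgML
    have hρ' : (ρ : ℤ) ≤ (Mu D : ℤ) + 1 := by exact_mod_cast hρ
    push_cast at this ⊢
    linarith
  · unfold kgqY; omega
  · unfold kgWY; omega

/-- **THE ROWS OF RECORD, SECOND AXIS, `ρ := 0`**. [this work] -/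
theorem kgYRows0_of (κ : Consts) {V : Type} [DecidableEq V] [Countable V] {G : SimpleGraph V} [G.LocallyFinite] (Φ : PlanarSkeletonFrmFrom G) (t : V) (p : unitInterval) (D : Skelφ.StepI.DataNS V) (g : ℕ) (f : ℕ) (mk qx Wx : ℕ) (hN : EqNumL κ Φ t p D g f) (hg : gFloorKG κ Φ t p D mk ≤ g) :
    KGYRows (nL κ Φ t p D g f) (ℓL κ Φ t p D g f) (hL κ Φ t p D g f) (vL κ Φ t p D g f) (kgR κ Φ t p D mk) 0 (kgqY κ Φ t p D g f qx)
      (kgWY κ Φ t p D g f Wx) :=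
  kgYRowsρ_of κ Φ t p D g f mk qx Wx 0 (Nat.zero_le _) hN hg (by simpa using hN.v_le)

end Rows0

/-! ## §3 The run length at `ρ := 0` -/

section RunLength0

variable (κ : Consts) {V : Type} [DecidableEq V] [Countable V] {G : SimpleGraph V} [G.LocallyFinite] (Φ : PlanarSkeletonFrmFrom G) (t : V) (p : unitInterval)
  (D : Skelφ.StepI.DataNS V) (g f mk qx Wx : ℕ)

/-- `kgNv0 ≤ ⌊tgt0⌋₊ / n_L`. [folklore] -/
theorem kgNv0_le_div (κ : Consts) {V : Type} [DecidableEq V] [Countable V] {G : SimpleGraph V} [G.LocallyFinite] (Φ : PlanarSkeletonFrmFrom G) (t : V) (p : unitInterval) (D : Skelφ.StepI.DataNS V) (g : ℕ) (f : ℕ) (mk : ℕ) (qx : ℕ) (Wx : ℕ) : kgNv0 κ Φ t p D g f mk qx Wx ≤ (kgTgt0 κ Φ t p D g f mk).toNat / nL κ Φ t p D g f := Skelφ.kgN_le _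

/-- `kgNYv0 ≤ ⌊tgtY0⌋₊ / ⌊sL⌋₊`. [folklore] -/
theorem kgNYv0_le_div (κ : Consts) {V : Type} [DecidableEq V] [Countable V] {G : SimpleGraph V} [G.LocallyFinite] (Φ : PlanarSkeletonFrmFrom G) (t : V) (p : unitInterval) (D : Skelφ.StepI.DataNS V) (g : ℕ) (f : ℕ) (mk : ℕ) (qx : ℕ) (Wx : ℕ) : kgNYv0 κ Φ t p D g f mk qx Wx ≤
    (kgTgtY0 κ Φ t p D g f mk).toNat / (kgSLY (nL κ Φ t p D g f) (ℓL κ Φ t p D g f) (hL κ Φ t p D g f)).toNat :=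
  Nat.findGreatest_le _

/-- `pitch ≤ tgt0` (so `0 ≤ tgt0`), under `EqNumL` (`1 ≤ n_L`). [folklore] -/
theorem pitch_le_kgTgt0 (κ : Consts) {V : Type} [DecidableEq V] [Countable V] {G : SimpleGraph V} [G.LocallyFinite] (Φ : PlanarSkeletonFrmFrom G) (t : V) (p : unitInterval) (D : Skelφ.StepI.DataNS V) (g : ℕ) (f : ℕ) (mk : ℕ) (hN : EqNumL κ Φ t p D g f) : pitch κ Φ t p D g f ≤ kgTgt0 κ Φ t p D g f mk ∧ 0 ≤ kgTgt0 κ Φ t p D g f mk := by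
  have hp := (kgTgt_nonneg κ Φ t p D g f mk).1
  have hn1 : (1 : ℤ) ≤ nL κ Φ t p D g f := by exact_mod_cast (one_le_of_eqNumL κ Φ t p D g f hN).1
  have h : pitch κ Φ t p D g f ≤ kgTgt0 κ Φ t p D g f mk := by
    unfold kgTgt0 Skelφ.kgΔ
    have ha : (0 : ℤ) ≤ |vL κ Φ t p D g f| := abs_nonneg _
    have h1 : (0 : ℤ) ≤ ((nL κ Φ t p D g f : ℤ) - 1) / 2 := Int.ediv_nonneg (by linarith) (by norm_num)
    have h2 : (0 : ℤ) ≤ ((nL κ Φ t p D g f : ℤ) + (8 * ((kgR κ Φ t p D mk : ℕ) : ℤ) + 7 * ((0 : ℕ) : ℤ) + |vL κ Φ t p D g f|)) / 2 :=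
      Int.ediv_nonneg (by positivity) (by norm_num)
    linarith
  exact ⟨h, hp.trans h⟩

/-- **`kgNv0 ≤ 20·K + 4`** (the centring offsets at `ρ = 0` are `≤ 2·n_L`). [this work] -/
theorem kgNv0_le (κ : Consts) {V : Type} [DecidableEq V] [Countable V] {G : SimpleGraph V} [G.LocallyFinite] (Φ : PlanarSkeletonFrmFrom G) (t : V) (p : unitInterval) (D : Skelφ.StepI.DataNS V) (g : ℕ) (f : ℕ) (mk : ℕ) (qx : ℕ) (Wx : ℕ) (hN : EqNumL κ Φ t p D g f) (hg : gFloorKG κ Φ t p D mk ≤ g) : kgNv0 κ Φ t p D g f mk qx Wx ≤ 20 * Neg.K κ + 4 := by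
  refine (kgNv0_le_div κ Φ t p D g f mk qx Wx).trans ?_
  have hnle := hN.n_le
  have hv := hN.v_le
  have hgML : g ≤ ML κ Φ t p D g := (ML_le_ML κ Φ t p D g).2
  unfold gFloorKG at hg
  have hfl : ((8 * KS0.R'0 κ Φ t p D mk + 3 * Mu D + 6 : ℕ) : ℤ) + 1 ≤ nL κ Φ t p D g f := by
    have : ((8 * KS0.R'0 κ Φ t p D mk + 3 * Mu D + 6 : ℕ) : ℤ) ≤ ML κ Φ t p D g := by exact_mod_cast hg.trans hgML
    linarith
  push_cast at hfl
  have htgt : kgTgt0 κ Φ t p D g f mk ≤ (nL κ Φ t p D g f : ℤ) * (20 * Neg.K κ + 4) := by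
    unfold kgTgt0 pitch Skelφ.kgΔ kgR
    have e1 := Int.ediv_mul_le ((nL κ Φ t p D g f : ℤ) - 1) (b := 2) (by norm_num)
    have e2 := Int.ediv_mul_le ((nL κ Φ t p D g f : ℤ) + (8 * ((KS0.R'0 κ Φ t p D mk : ℕ) : ℤ) + 7 * ((0 : ℕ) : ℤ) + |vL κ Φ t p D g f|)) (b := 2)
      (by norm_num)
    push_cast at e1 e2 ⊢
    nlinarith
  have h0 := (pitch_le_kgTgt0 κ Φ t p D g f mk hN).2
  have hcast : (((kgTgt0 κ Φ t p D g f mk).toNat : ℕ) : ℤ) ≤ ((nL κ Φ t p D g f * (20 * Neg.K κ + 4) : ℕ) : ℤ) := by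
    rw [Int.toNat_of_nonneg h0]; push_cast; exact htgt
  exact Nat.div_le_of_le_mul (by exact_mod_cast hcast)

end RunLength0

end NegB

end PlanarSkeletonFrmFrom

end Summit.CriticalPhenomena.PercolationContinuityZ3.Theorems.Transplant

end
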